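import Mathlib
import HarnessLib
import Literature.MathematicalPhysics.QuantumLattice.GaugeGroups
import Literature.MathematicalPhysics.QuantumFieldTheory.ConstructiveQFTWave0
import Literature.MathematicalPhysics.QuantumFieldTheory.LatticeGaugeProofs
import Summits.Ventures.LatticeQCDFlow.Scaling.FluxTunnellingU1Explicit
import Summits.Ventures.LatticeQCDFlow.Scaling.FluxTunnelling

/-!
# LatticeQCDFlow / Scaling — the EXPLICIT single-link tunnelling law for 2-d `U(1)`: `z₁(β)³·(μ_{β,L} ⊗ κ){Q ≠ Q'} ≤ 2e^{−2β}`

HONEST FRAMING: exact (Metropolis-corrected) sampling algorithms for lattice gauge theory; figures of merit are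
autocorrelation/cost numbers at stated couplings and volumes; no continuum-physics claim.

Venture `LatticeQCDFlow` (cell pub-lqcd), topic `Scaling`, FANOUT row 30 (lean-1) — OUR WORK, file 5 (the law) of the
explicit `U(1)` tunnelling programme.  Theory-2's `Flux.compProd_topCharge_ne_le_of_links_sharp`
(`Scaling/FluxTunnelling.lean`): an exact sampler of ANY law `m` that updates the single link `e₀` changes the plane
topological charge with stationary probability `≤ 2·m{S_P ≥ #P(1 − cos(π/#P))}`, `P` the (one or two) plane
positions whose plaquette contains `e₀` — threshold `= 2` in both cases.  `Scaling/FluxTunnellingU1Explicit.lean`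
bounds that mass for the 2-d Wilson measure of `U(1)` at even volume.  Here the two are joined:

* `planeSite_eq_iff`, `card_touched_le_two` — bookkeeping: the plane positions touched by one link are at most two;
* **`u1_tunnelling_single_link`** — for every even `L ≥ 2`, `β ≥ 0`, site `x₀` (origin of the plane coordinates),
  link `e₀`, and every Markov kernel `κ` leaving `μ_{β,L}` invariant whose steps `μ_{β,L} ⊗ κ`-a.s. change only `e₀`:
  `z₁(β)³ · (μ_{β,L} ⊗ κ){Q ≠ Q'} ≤ 2·e^{−2β}` (`u1_pow_three_mul_measure_linkPatch_le`: the per-link thick-plaquette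
  tail `z₁³·μ{S_P ≥ 2} ≤ e^{−2β}`); **`u1_tunnelling_sweep_nsteps`** — for any process with one-time marginals `μ_{β,L}`
  whose `k`-th step changes only one link (sweeps): `z₁(β)³·P{Q(Z_n) ≠ Q(Z_0)} ≤ n·2·e^{−2β}`;
* `u1_sq_mul_measure_cutTail_le`, **`u1_tunnelling_small_step`** — the same for `ρ`-SMALL-STEP kernels (HMC /
  flow proposals): `z₁(β)²·μ_{β,L}{‖U_x + 1‖ ≤ s} ≤ e^{−β(2 − s²/2)}` and
  `z₁(β)²·(μ_{β,L} ⊗ κ){Q ≠ Q'} ≤ 2L²·e^{−β(2 − 8ρ²)}` (theory-2's `compProd_topCharge_ne_le_of_plaquetteTail`);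
* **`u1_tunnelling_links`** — LINK-LOCAL updates (masked / domain-decomposed flow proposals, multi-link heat
  bath): for a link set touching `m` plane positions (`m ≤ 2n`, `2n + 2 ≤ L²`),
  `z₁(β)^{n+m}·(μ_{β,L} ⊗ κ){Q ≠ Q'} ≤ 2·e^{−β·m(1 − cos(π/m))}` (theory-2's sharp patch threshold);
* **`u1_tunnelling_single_link_explicit`** — for `β ≥ 1`, with `z₁(β) ≥ e^{−1/2}/(π√β)`:
  `(μ_{β,L} ⊗ κ){Q ≠ Q'} ≤ 2·(e^{1/2}π)³·β^{3/2}·e^{−2β}` — every exact single-link sampler (heat bath, Metropolis,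
  any proposal with a Metropolis filter) of 2-d compact `U(1)` keeps the topological charge frozen for
  `≳ e^{2β}/(280·β^{3/2})` steps in equilibrium, UNIFORMLY IN THE (even) VOLUME.  The exponent `2β` is the sharp
  single-link barrier of `Scaling/CosineBudget.lean`; the prefactor `β^{3/2}` is not optimised.

Elementary given files 1–4; nothing is cited as a fact; no `def`.
-/

noncomputable section

namespace Summit.Ventures.LatticeQCDFlow.Theory2.Lattice.TwoDim

open MeasureTheory ProbabilityTheory Literature.MathematicalPhysics.QuantumFieldTheory
open Literature.MathematicalPhysics.QuantumLattice (u1Rep u1Rep_apply continuous_u1Rep)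
open Summit.Ventures.LatticeQCDFlow.Theory2.Lattice.Flux
open scoped ENNReal

variable {L : ℕ}

/-! ## §1. Plane positions touched by one link -/

/-- Plane coordinates relative to `x₀` (plane `(0,1)`, `d = 2`) are a bijection: `planeSite x₀ 0 1 p = z` iff
`p = ((z − x₀) 0, (z − x₀) 1)`. [folklore] -/
theorem planeSite_eq_iff (x₀ z : Site 2 L) (p : ZMod L × ZMod L) :
    planeSite x₀ 0 1 p = z ↔ p = ((z - x₀) 0, (z - x₀) 1) := by
  constructor
  · intro h
    have h0 := congrFun h 0
    have h1 := congrFun h 1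
    simp only [planeSite, Pi.add_apply, Pi.single_eq_same,
      Pi.single_eq_of_ne (show (0 : Fin 2) ≠ 1 by decide),
      Pi.single_eq_of_ne (show (1 : Fin 2) ≠ 0 by decide), add_zero] at h0 h1
    refine Prod.ext ?_ ?_
    · simp only [Pi.sub_apply, ← h0]; ring
    · simp only [Pi.sub_apply, ← h1]; ring
  · rintro rfl
    funext j
    fin_cases j <;> simp [planeSite]

/-- The plane positions whose plaquette contains a given link `e₀ = (y, i)` are among the two positions of `y`
and `y − e_{1−i}`; in particular there are at most two of them. [folklore] -/
theorem card_touched_le_two [NeZero L] (x₀ : Site 2 L) (e₀ : Edge 2 L) :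
    (Finset.univ.filter fun p : ZMod L × ZMod L => e₀ ∈ plaqLinks (planeSite x₀ 0 1 p) 0 1).card ≤ 2 := by
  classical
  obtain ⟨y, i⟩ := e₀
  -- the second candidate site
  let y' : Site 2 L := y - Pi.single (if i = 0 then (1 : Fin 2) else 0) 1
  have hsub : (Finset.univ.filter fun p : ZMod L × ZMod L => (y, i) ∈ plaqLinks (planeSite x₀ 0 1 p) 0 1) ⊆
      {((y - x₀) 0, (y - x₀) 1), ((y' - x₀) 0, (y' - x₀) 1)} := by
    intro p hp
    rw [Finset.mem_filter] at hp
    obtain ⟨-, hp⟩ := hp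
    simp only [plaqLinks, Finset.mem_insert, Finset.mem_singleton, Prod.mk.injEq] at hp
    rw [Finset.mem_insert, Finset.mem_singleton, ← planeSite_eq_iff, ← planeSite_eq_iff]
    rcases hp with ⟨h1, h2⟩ | ⟨h1, h2⟩ | ⟨h1, h2⟩ | ⟨h1, h2⟩
    · exact Or.inl h1.symm
    · right; subst h2
      simp only [y']; rw [h1]; simp [Site.shift]
    · right; subst h2
      simp only [y']; rw [h1]; simp [Site.shift]
    · exact Or.inl h1.symm
  exact (Finset.card_le_card hsub).trans (Finset.card_insert_le _ _ |>.trans (by simp))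

/-! ## §2. The law -/

/-- **PER-LINK THICK-PLAQUETTE TAIL**: for the (one or two) plane positions `P` touched by a link `e₀`,
`z₁(β)³ · μ_{β,L}{S_P ≥ #P(1 − cos(π/#P))} ≤ e^{−2β}` (`L` even, `β ≥ 0`; the threshold is `2`). [folklore] -/
theorem u1_pow_three_mul_measure_linkPatch_le [NeZero L] (hL : 2 ≤ L) (hLe : Even L) {β : ℝ} (hβ : 0 ≤ β)
    (x₀ : Site 2 L) (e₀ : Edge 2 L) :
    z1 u1Rep β ^ 3 * wilsonMeasure (d := 2) (L := L) u1Rep β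
        {U | ((Finset.univ.filter fun p : ZMod L × ZMod L => e₀ ∈ plaqLinks (planeSite x₀ 0 1 p) 0 1).card : ℝ) *
            (1 - Real.cos (Real.pi /
              (Finset.univ.filter fun p : ZMod L × ZMod L => e₀ ∈ plaqLinks (planeSite x₀ 0 1 p) 0 1).card)) ≤
          patchAction x₀ 0 1
            (Finset.univ.filter fun p : ZMod L × ZMod L => e₀ ∈ plaqLinks (planeSite x₀ 0 1 p) 0 1) U} ≤
      ENNReal.ofReal (Real.exp (-(2 * β))) := by
  classical
  set P' : Finset (ZMod L × ZMod L) :=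
    Finset.univ.filter fun p => e₀ ∈ plaqLinks (planeSite x₀ 0 1 p) 0 1 with hP'
  have hPne : P'.Nonempty := by
    refine ⟨((e₀.1 - x₀) 0, (e₀.1 - x₀) 1), Finset.mem_filter.mpr ⟨Finset.mem_univ _, ?_⟩⟩
    rw [(planeSite_eq_iff x₀ e₀.1 _).mpr rfl]
    obtain ⟨y, i⟩ := e₀
    fin_cases i <;> simp [plaqLinks]
  have hcard : P'.card ≤ 2 := card_touched_le_two x₀ e₀
  -- the threshold is `2` for one or two touched plaquettes
  have hthr : (P'.card : ℝ) * (1 - Real.cos (Real.pi / P'.card)) = 2 := by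
    have h1 : 1 ≤ P'.card := hPne.card_pos
    interval_cases h : P'.card
    · simp [Real.cos_pi]; norm_num
    · simp [Real.cos_pi_div_two]
  -- the patch as a set of sites
  set P : Finset (Site 2 L) := P'.image (planeSite x₀ 0 1) with hPdef
  have hinj : Set.InjOn (planeSite x₀ 0 1) (P' : Set (ZMod L × ZMod L)) := by
    intro p _ q _ hpq
    rw [(planeSite_eq_iff x₀ _ p).mp hpq, ← (planeSite_eq_iff x₀ _ q).mp rfl]
  have hPcard : P.card ≤ 2 * 1 := by rw [hPdef, Finset.card_image_of_injOn hinj]; omega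
  have hset : {U : GaugeConfig 2 L Circle | (P'.card : ℝ) * (1 - Real.cos (Real.pi / P'.card)) ≤
      patchAction x₀ 0 1 P' U} =
      {U | (2 : ℝ) ≤ ∑ x ∈ P, (1 - ((plaquetteHolonomy U x 0 1 : Circle) : ℂ).re)} := by
    ext U
    simp only [Set.mem_setOf_eq, hthr, patchAction, hPdef, Finset.sum_image hinj]
  have hn : 2 * 1 + 2 ≤ L ^ 2 := by nlinarith
  have htail := u1_pow_mul_measure_actionSum_ge_le hL hLe hβ P 1 hPcard hn 2
  have hz1 : z1 u1Rep β ≤ 1 := z1_le_one u1Rep U1.re_trace_u1Rep_le hβ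
  rw [hset]
  calc z1 u1Rep β ^ 3 * wilsonMeasure (d := 2) (L := L) u1Rep β
          {U | (2 : ℝ) ≤ ∑ x ∈ P, (1 - ((plaquetteHolonomy U x 0 1 : Circle) : ℂ).re)}
      ≤ z1 u1Rep β ^ (1 + P.card) * wilsonMeasure (d := 2) (L := L) u1Rep β
          {U | (2 : ℝ) ≤ ∑ x ∈ P, (1 - ((plaquetteHolonomy U x 0 1 : Circle) : ℂ).re)} :=
        mul_le_mul' (pow_le_pow_right_of_le_one' hz1 (by omega)) le_rfl
    _ ≤ ENNReal.ofReal (Real.exp (-(β * 2))) := htail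
    _ = ENNReal.ofReal (Real.exp (-(2 * β))) := by rw [mul_comm β 2]

/-- **THE EXPLICIT SINGLE-LINK TUNNELLING LAW FOR 2-d `U(1)`.**  For every even `L ≥ 2`, `β ≥ 0`, site `x₀`,
link `e₀` and Markov kernel `κ` leaving the Wilson measure `μ_{β,L}` invariant whose steps `μ_{β,L} ⊗ κ`-a.s. change
only the link `e₀`: `z₁(β)³ · (μ_{β,L} ⊗ κ){Q ≠ Q'} ≤ 2·e^{−2β}`, `Q` the topological charge of the plane through
`x₀`. [folklore] -/
theorem u1_tunnelling_single_link [NeZero L] (hL : 2 ≤ L) (hLe : Even L) {β : ℝ} (hβ : 0 ≤ β)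
    (x₀ : Site 2 L) (e₀ : Edge 2 L)
    (κ : Kernel (GaugeConfig 2 L Circle) (GaugeConfig 2 L Circle)) [IsMarkovKernel κ]
    (hinv : κ.Invariant (wilsonMeasure (d := 2) (L := L) u1Rep β))
    (hloc : ∀ᵐ q ∂((wilsonMeasure (d := 2) (L := L) u1Rep β) ⊗ₘ κ), ∀ e, e ≠ e₀ → q.1 e = q.2 e) :
    z1 u1Rep β ^ 3 * ((wilsonMeasure (d := 2) (L := L) u1Rep β) ⊗ₘ κ)
        {q | Flux.topCharge x₀ 0 1 q.1 ≠ Flux.topCharge x₀ 0 1 q.2} ≤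
      2 * ENNReal.ofReal (Real.exp (-(2 * β))) := by
  classical
  set μW := wilsonMeasure (d := 2) (L := L) u1Rep β with hμW
  haveI : IsProbabilityMeasure μW := isProbabilityMeasure_wilsonMeasure u1Rep continuous_u1Rep β
  set P' : Finset (ZMod L × ZMod L) :=
    Finset.univ.filter fun p => e₀ ∈ plaqLinks (planeSite x₀ 0 1 p) 0 1 with hP'
  have hP : ∀ p, (∃ e ∈ plaqLinks (planeSite x₀ 0 1 p) 0 1, e ∈ ({e₀} : Finset (Edge 2 L))) → p ∈ P' := by
    rintro p ⟨e, he, he0⟩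
    rw [Finset.mem_singleton] at he0
    subst he0
    exact Finset.mem_filter.mpr ⟨Finset.mem_univ _, he⟩
  have hPne : P'.Nonempty := by
    refine ⟨((e₀.1 - x₀) 0, (e₀.1 - x₀) 1), Finset.mem_filter.mpr ⟨Finset.mem_univ _, ?_⟩⟩
    rw [(planeSite_eq_iff x₀ e₀.1 _).mpr rfl]
    obtain ⟨y, i⟩ := e₀
    fin_cases i <;> simp [plaqLinks]
  have hloc' : ∀ᵐ q ∂(μW ⊗ₘ κ), ∀ e ∉ ({e₀} : Finset (Edge 2 L)), q.1 e = q.2 e := by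
    filter_upwards [hloc] with q hq e he
    exact hq e (fun h => he (Finset.mem_singleton.mpr h))
  have hlaw := compProd_topCharge_ne_le_of_links_sharp x₀ 0 1 {e₀} hPne hP μW κ hinv hloc'
  have htail := u1_pow_three_mul_measure_linkPatch_le hL hLe hβ x₀ e₀
  calc z1 u1Rep β ^ 3 * (μW ⊗ₘ κ) {q | Flux.topCharge x₀ 0 1 q.1 ≠ Flux.topCharge x₀ 0 1 q.2}
      ≤ z1 u1Rep β ^ 3 * (2 * μW {U | (P'.card : ℝ) * (1 - Real.cos (Real.pi / P'.card)) ≤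
          patchAction x₀ 0 1 P' U}) := mul_le_mul' le_rfl hlaw
    _ = 2 * (z1 u1Rep β ^ 3 * μW {U | (P'.card : ℝ) * (1 - Real.cos (Real.pi / P'.card)) ≤
          patchAction x₀ 0 1 P' U}) := by ring
    _ ≤ 2 * ENNReal.ofReal (Real.exp (-(2 * β))) := mul_le_mul' le_rfl htail

/-- **THE EXPLICIT SWEEP LAW** (`n` steps): for a process `Z₀, Z₁, …` of configurations with all one-time marginals
equal to `μ_{β,L}` (e.g. a stationary exact chain) whose `k`-th step a.s. changes only the link `e k` (a sweep in any
order, random or systematic), `z₁(β)³ · P{Q(Z_n) ≠ Q(Z_0)} ≤ n·2·e^{−2β}` — every exact link-by-link sampler of 2-d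
`U(1)` keeps the topological charge for `≳ z₁(β)³e^{2β}/2` link updates. [folklore] -/
theorem u1_tunnelling_sweep_nsteps [NeZero L] (hL : 2 ≤ L) (hLe : Even L) {β : ℝ} (hβ : 0 ≤ β)
    (x₀ : Site 2 L) {Ω : Type*} [MeasurableSpace Ω] (P : Measure Ω) (Z : ℕ → Ω → GaugeConfig 2 L Circle)
    (hZ : ∀ k, Measurable (Z k)) (hmarg : ∀ k, P.map (Z k) = wilsonMeasure (d := 2) (L := L) u1Rep β)
    (e : ℕ → Edge 2 L) (hloc : ∀ k, ∀ᵐ ω ∂P, ∀ e', e' ≠ e k → Z k ω e' = Z (k + 1) ω e') (n : ℕ) :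
    z1 u1Rep β ^ 3 * P {ω | Flux.topCharge x₀ 0 1 (Z n ω) ≠ Flux.topCharge x₀ 0 1 (Z 0 ω)} ≤
      n * (2 * ENNReal.ofReal (Real.exp (-(2 * β)))) := by
  classical
  set μW := wilsonMeasure (d := 2) (L := L) u1Rep β with hμW
  have hz0 : z1 u1Rep β ≠ 0 := fun h => by
    have := exp_neg_two_mul_le_z1 hβ
    rw [h, nonpos_iff_eq_zero, ENNReal.ofReal_eq_zero] at this
    exact absurd this (not_le.mpr (Real.exp_pos _))
  have hzt : z1 u1Rep β ≠ ⊤ :=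
    ne_top_of_le_ne_top ENNReal.one_ne_top (z1_le_one u1Rep U1.re_trace_u1Rep_le hβ)
  have hz3 : z1 u1Rep β ^ 3 ≠ 0 := pow_ne_zero _ hz0
  have hz3t : z1 u1Rep β ^ 3 ≠ ⊤ := ENNReal.pow_ne_top hzt
  -- patches and thick-plaquette sets step by step
  let Pk : ℕ → Finset (ZMod L × ZMod L) := fun k =>
    Finset.univ.filter fun p => e k ∈ plaqLinks (planeSite x₀ 0 1 p) 0 1
  let B : ℕ → Set (GaugeConfig 2 L Circle) := fun k =>
    {U | ((Pk k).card : ℝ) * (1 - Real.cos (Real.pi / (Pk k).card)) ≤ patchAction x₀ 0 1 (Pk k) U}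
  have hPne : ∀ k, (Pk k).Nonempty := by
    intro k
    refine ⟨(((e k).1 - x₀) 0, ((e k).1 - x₀) 1), Finset.mem_filter.mpr ⟨Finset.mem_univ _, ?_⟩⟩
    rw [(planeSite_eq_iff x₀ (e k).1 _).mpr rfl]
    obtain ⟨y, i⟩ := e k
    fin_cases i <;> simp [plaqLinks]
  have hP : ∀ k p, (∃ e' ∈ plaqLinks (planeSite x₀ 0 1 p) 0 1, e' ∈ ({e k} : Finset (Edge 2 L))) → p ∈ Pk k := by
    rintro k p ⟨e', he', he0⟩
    rw [Finset.mem_singleton] at he0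
    subst he0
    exact Finset.mem_filter.mpr ⟨Finset.mem_univ _, he'⟩
  have hB : ∀ k ⦃U U' : GaugeConfig 2 L Circle⦄, (∀ e', e' ≠ e k → U e' = U' e') →
      Flux.topCharge x₀ 0 1 U ≠ Flux.topCharge x₀ 0 1 U' → U ∈ B k ∨ U' ∈ B k := by
    intro k U U' hUU' hQ
    have hoff := plaquette_eq_off_patch_of_links (hP k) (U := U) (U' := U')
      (fun e' he' => hUU' e' (fun h => he' (Finset.mem_singleton.mpr h)))
    exact patchAction_ge_sharp_or_of_topCharge_ne x₀ 0 1 (hPne k) hoff hQ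
  have htail : ∀ k, μW (B k) ≤ (z1 u1Rep β ^ 3)⁻¹ * ENNReal.ofReal (Real.exp (-(2 * β))) := by
    intro k
    rw [← ENNReal.mul_le_mul_iff_right hz3 hz3t, ← mul_assoc, ENNReal.mul_inv_cancel hz3 hz3t, one_mul]
    exact u1_pow_three_mul_measure_linkPatch_le hL hLe hβ x₀ (e k)
  have hm : ∀ k, P (Z k ⁻¹' B k) + P (Z (k + 1) ⁻¹' B k) ≤
      2 * ((z1 u1Rep β ^ 3)⁻¹ * ENNReal.ofReal (Real.exp (-(2 * β)))) := by
    intro k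
    have hle : ∀ j, P (Z j ⁻¹' B k) ≤ μW (B k) := fun j => by
      rw [← hmarg j]; exact Measure.le_map_apply (hZ j).aemeasurable _
    rw [two_mul]
    exact add_le_add ((hle k).trans (htail k)) ((hle (k + 1)).trans (htail k))
  have hn := Tunnelling.measure_chargeChange_le_nsteps (R := fun k (U U' : GaugeConfig 2 L Circle) =>
    ∀ e', e' ≠ e k → U e' = U' e') (Q := Flux.topCharge x₀ 0 1) (B := B) hB P Z hloc hm n
  calc z1 u1Rep β ^ 3 * P {ω | Flux.topCharge x₀ 0 1 (Z n ω) ≠ Flux.topCharge x₀ 0 1 (Z 0 ω)}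
      ≤ z1 u1Rep β ^ 3 * (n * (2 * ((z1 u1Rep β ^ 3)⁻¹ * ENNReal.ofReal (Real.exp (-(2 * β)))))) :=
        mul_le_mul' le_rfl hn
    _ = (z1 u1Rep β ^ 3 * (z1 u1Rep β ^ 3)⁻¹) * (n * (2 * ENNReal.ofReal (Real.exp (-(2 * β))))) := by ring
    _ = _ := by rw [ENNReal.mul_inv_cancel hz3 hz3t, one_mul]

/-- **THE EXPLICIT LAW IN NUMBERS** (`β ≥ 1`): `(μ_{β,L} ⊗ κ){Q ≠ Q'} ≤ 2·(e^{1/2}·π·√β)³·e^{−2β}` for every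
exact single-link sampler of 2-d `U(1)` at every even volume — topological freezing at rate `e^{2β}` up to a
power of `β`. [folklore] -/
theorem u1_tunnelling_single_link_explicit [NeZero L] (hL : 2 ≤ L) (hLe : Even L) {β : ℝ} (hβ : 1 ≤ β)
    (x₀ : Site 2 L) (e₀ : Edge 2 L)
    (κ : Kernel (GaugeConfig 2 L Circle) (GaugeConfig 2 L Circle)) [IsMarkovKernel κ]
    (hinv : κ.Invariant (wilsonMeasure (d := 2) (L := L) u1Rep β))
    (hloc : ∀ᵐ q ∂((wilsonMeasure (d := 2) (L := L) u1Rep β) ⊗ₘ κ), ∀ e, e ≠ e₀ → q.1 e = q.2 e) :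
    ((wilsonMeasure (d := 2) (L := L) u1Rep β) ⊗ₘ κ) {q | Flux.topCharge x₀ 0 1 q.1 ≠ Flux.topCharge x₀ 0 1 q.2} ≤
      ENNReal.ofReal (2 * (Real.exp (1 / 2) * Real.pi * Real.sqrt β) ^ 3 * Real.exp (-(2 * β))) := by
  have hβ0 : 0 ≤ β := by linarith
  have h := u1_tunnelling_single_link hL hLe hβ0 x₀ e₀ κ hinv hloc
  have hz := inv_sqrt_le_z1 hβ
  set r : ℝ := Real.exp (-(1 / 2)) * (1 / Real.pi * (Real.sqrt β)⁻¹) with hr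
  have hr0 : 0 < r := by
    have : 0 < Real.sqrt β := Real.sqrt_pos.mpr (by linarith)
    positivity
  have hz3 : ENNReal.ofReal (r ^ 3) ≤ z1 u1Rep β ^ 3 := by
    rw [ENNReal.ofReal_pow hr0.le]; exact pow_le_pow_left' hz 3
  set X := ((wilsonMeasure (d := 2) (L := L) u1Rep β) ⊗ₘ κ)
    {q | Flux.topCharge x₀ 0 1 q.1 ≠ Flux.topCharge x₀ 0 1 q.2} with hX
  have hrX : ENNReal.ofReal (r ^ 3) * X ≤ ENNReal.ofReal (2 * Real.exp (-(2 * β))) := by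
    calc ENNReal.ofReal (r ^ 3) * X ≤ z1 u1Rep β ^ 3 * X := by gcongr
      _ ≤ 2 * ENNReal.ofReal (Real.exp (-(2 * β))) := h
      _ = ENNReal.ofReal (2 * Real.exp (-(2 * β))) := by
          rw [ENNReal.ofReal_mul (by norm_num : (0:ℝ) ≤ 2), ENNReal.ofReal_ofNat]
  have hr3 : ENNReal.ofReal (r ^ 3) ≠ 0 := (ENNReal.ofReal_pos.mpr (pow_pos hr0 3)).ne'
  calc X ≤ ENNReal.ofReal (2 * Real.exp (-(2 * β))) / ENNReal.ofReal (r ^ 3) :=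
        (ENNReal.le_div_iff_mul_le (Or.inl hr3) (Or.inl ENNReal.ofReal_ne_top)).mpr
          (by rw [mul_comm]; exact hrX)
    _ = ENNReal.ofReal (2 * Real.exp (-(2 * β)) / r ^ 3) := (ENNReal.ofReal_div_of_pos (pow_pos hr0 3)).symm
    _ = ENNReal.ofReal (2 * (Real.exp (1 / 2) * Real.pi * Real.sqrt β) ^ 3 * Real.exp (-(2 * β))) := by
        congr 1
        have hsq : 0 < Real.sqrt β := Real.sqrt_pos.mpr (by linarith)
        have hr' : r = (Real.exp (1 / 2) * Real.pi * Real.sqrt β)⁻¹ := by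
          rw [hr, Real.exp_neg]
          field_simp
        rw [hr', inv_pow, div_inv_eq_mul]
        ring

/-! ## §3. Small steps (HMC / flow proposals with bounded displacement) -/

/-- `1 + Re u = ‖u + 1‖²/2` on the unit circle. [folklore] -/
theorem circle_one_add_re_eq (u : Circle) : 1 + (u : ℂ).re = ‖(u : ℂ) + 1‖ ^ 2 / 2 := by
  have h1 : Complex.normSq (u : ℂ) = 1 := Circle.normSq_coe u
  rw [Complex.normSq_apply] at h1
  rw [Complex.sq_norm, Complex.normSq_apply, Complex.add_re, Complex.add_im, Complex.one_re,
    Complex.one_im]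
  linear_combination (-(1 : ℝ) / 2) * h1

/-- **ONE-PLAQUETTE CUT TAIL** (2-d `U(1)`, `L` even, `β ≥ 0`): `z₁(β)² · μ_{β,L}{‖U_x + 1‖ ≤ s} ≤ e^{−β(2 − s²/2)}` —
the hypothesis `η` of theory-2's small-step law, explicitly. [folklore] -/
theorem u1_sq_mul_measure_cutTail_le [NeZero L] (hL : 2 ≤ L) (hLe : Even L) {β : ℝ} (hβ : 0 ≤ β)
    (x : Site 2 L) (s : ℝ) :
    z1 u1Rep β ^ 2 * wilsonMeasure (d := 2) (L := L) u1Rep β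
        {U | ‖((plaquetteHolonomy U x 0 1 : Circle) : ℂ) + 1‖ ≤ s} ≤
      ENNReal.ofReal (Real.exp (-(β * (2 - s ^ 2 / 2)))) := by
  classical
  have hn : 2 * 1 + 2 ≤ L ^ 2 := by nlinarith
  have h := u1_pow_mul_measure_actionSum_ge_le hL hLe hβ {x} 1 (by simp) hn (2 - s ^ 2 / 2)
  rw [Finset.card_singleton, show 1 + 1 = 2 by rfl] at h
  refine le_trans (mul_le_mul' le_rfl (measure_mono fun U hU => ?_)) h
  simp only [Set.mem_setOf_eq, Finset.sum_singleton] at hU ⊢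
  have hre := circle_one_add_re_eq (plaquetteHolonomy U x 0 1 : Circle)
  have hs : ‖((plaquetteHolonomy U x 0 1 : Circle) : ℂ) + 1‖ ^ 2 ≤ s ^ 2 :=
    pow_le_pow_left₀ (norm_nonneg _) hU 2
  linarith

/-- **THE EXPLICIT SMALL-STEP TUNNELLING LAW FOR 2-d `U(1)`**: for every even `L ≥ 2`, `β ≥ 0` and every Markov
kernel leaving `μ_{β,L}` invariant whose steps are `μ_{β,L} ⊗ κ`-a.s. `ρ`-small in the sup metric on the links
(HMC / flow proposals with bounded displacement), `z₁(β)² · (μ_{β,L} ⊗ κ){Q ≠ Q'} ≤ 2L²·e^{−β(2 − 8ρ²)}`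
(theory-2's `Flux.compProd_topCharge_ne_le_of_plaquetteTail` with the explicit tail). [folklore] -/
theorem u1_tunnelling_small_step [NeZero L] (hL : 2 ≤ L) (hLe : Even L) {β : ℝ} (hβ : 0 ≤ β)
    (x₀ : Site 2 L) (κ : Kernel (GaugeConfig 2 L Circle) (GaugeConfig 2 L Circle)) [IsMarkovKernel κ]
    (hinv : κ.Invariant (wilsonMeasure (d := 2) (L := L) u1Rep β)) {ρ : ℝ}
    (hstep : ∀ᵐ q ∂((wilsonMeasure (d := 2) (L := L) u1Rep β) ⊗ₘ κ), dist q.1 q.2 ≤ ρ) :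
    z1 u1Rep β ^ 2 * ((wilsonMeasure (d := 2) (L := L) u1Rep β) ⊗ₘ κ)
        {q | Flux.topCharge x₀ 0 1 q.1 ≠ Flux.topCharge x₀ 0 1 q.2} ≤
      2 * ((L : ℝ≥0∞) ^ 2 * ENNReal.ofReal (Real.exp (-(β * (2 - (4 * ρ) ^ 2 / 2))))) := by
  set μW := wilsonMeasure (d := 2) (L := L) u1Rep β with hμW
  haveI : IsProbabilityMeasure μW := isProbabilityMeasure_wilsonMeasure u1Rep continuous_u1Rep β
  have hz0 : z1 u1Rep β ≠ 0 := fun h => by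
    have := exp_neg_two_mul_le_z1 hβ
    rw [h, nonpos_iff_eq_zero, ENNReal.ofReal_eq_zero] at this
    exact absurd this (not_le.mpr (Real.exp_pos _))
  have hzt : z1 u1Rep β ≠ ⊤ :=
    ne_top_of_le_ne_top ENNReal.one_ne_top (z1_le_one u1Rep U1.re_trace_u1Rep_le hβ)
  have hz2 : z1 u1Rep β ^ 2 ≠ 0 := pow_ne_zero _ hz0
  have hz2t : z1 u1Rep β ^ 2 ≠ ⊤ := ENNReal.pow_ne_top hzt
  -- the explicit tail `η`
  have hη : ∀ p : ZMod L × ZMod L,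
      μW {U | ‖((plaquetteHolonomy U (planeSite x₀ 0 1 p) 0 1 : Circle) : ℂ) + 1‖ ≤ 4 * ρ} ≤
        (z1 u1Rep β ^ 2)⁻¹ * ENNReal.ofReal (Real.exp (-(β * (2 - (4 * ρ) ^ 2 / 2)))) := by
    intro p
    rw [← ENNReal.mul_le_mul_iff_right hz2 hz2t, ← mul_assoc, ENNReal.mul_inv_cancel hz2 hz2t, one_mul]
    exact u1_sq_mul_measure_cutTail_le hL hLe hβ _ _
  have hlaw := compProd_topCharge_ne_le_of_plaquetteTail x₀ 0 1 μW κ hinv hstep hη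
  calc z1 u1Rep β ^ 2 * (μW ⊗ₘ κ) {q | Flux.topCharge x₀ 0 1 q.1 ≠ Flux.topCharge x₀ 0 1 q.2}
      ≤ z1 u1Rep β ^ 2 * (2 * ((L : ℝ≥0∞) ^ 2 *
          ((z1 u1Rep β ^ 2)⁻¹ * ENNReal.ofReal (Real.exp (-(β * (2 - (4 * ρ) ^ 2 / 2))))))) :=
        mul_le_mul' le_rfl hlaw
    _ = (z1 u1Rep β ^ 2 * (z1 u1Rep β ^ 2)⁻¹) *
          (2 * ((L : ℝ≥0∞) ^ 2 * ENNReal.ofReal (Real.exp (-(β * (2 - (4 * ρ) ^ 2 / 2)))))) := by ring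
    _ = _ := by rw [ENNReal.mul_inv_cancel hz2 hz2t, one_mul]

/-! ## §4. Link-local (patch / masked-flow) updates -/

/-- **THE EXPLICIT PATCH TUNNELLING LAW FOR 2-d `U(1)`**: for every even `L`, `β ≥ 0`, every finite link set `Λ`
(a masked or domain-decomposed flow proposal with a Metropolis filter, a multi-link heat bath, …), every
non-empty set `P` of `m` plane positions containing those whose plaquette touches `Λ`, and `n` with `m ≤ 2n`,
`2n + 2 ≤ L²`: every Markov kernel leaving `μ_{β,L}` invariant whose steps a.s. change only links of `Λ` satisfies
`z₁(β)^{n+m} · (μ_{β,L} ⊗ κ){Q ≠ Q'} ≤ 2·e^{−β·m(1 − cos(π/m))}` (theory-2's sharp patch threshold,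
`Scaling/CosineBudget.lean`). [folklore] -/
theorem u1_tunnelling_links [NeZero L] (hL : 2 ≤ L) (hLe : Even L) {β : ℝ} (hβ : 0 ≤ β)
    (x₀ : Site 2 L) (Λ : Finset (Edge 2 L)) {P : Finset (ZMod L × ZMod L)} (hPne : P.Nonempty)
    (hP : ∀ p, (∃ e ∈ plaqLinks (planeSite x₀ 0 1 p) 0 1, e ∈ Λ) → p ∈ P)
    (n : ℕ) (hPn : P.card ≤ 2 * n) (hn : 2 * n + 2 ≤ L ^ 2)
    (κ : Kernel (GaugeConfig 2 L Circle) (GaugeConfig 2 L Circle)) [IsMarkovKernel κ]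
    (hinv : κ.Invariant (wilsonMeasure (d := 2) (L := L) u1Rep β))
    (hloc : ∀ᵐ q ∂((wilsonMeasure (d := 2) (L := L) u1Rep β) ⊗ₘ κ), ∀ e ∉ Λ, q.1 e = q.2 e) :
    z1 u1Rep β ^ (n + P.card) * ((wilsonMeasure (d := 2) (L := L) u1Rep β) ⊗ₘ κ)
        {q | Flux.topCharge x₀ 0 1 q.1 ≠ Flux.topCharge x₀ 0 1 q.2} ≤
      2 * ENNReal.ofReal (Real.exp (-(β * ((P.card : ℝ) * (1 - Real.cos (Real.pi / P.card)))))) := by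
  classical
  set μW := wilsonMeasure (d := 2) (L := L) u1Rep β with hμW
  haveI : IsProbabilityMeasure μW := isProbabilityMeasure_wilsonMeasure u1Rep continuous_u1Rep β
  have hlaw := compProd_topCharge_ne_le_of_links_sharp x₀ 0 1 Λ hPne hP μW κ hinv hloc
  set PS : Finset (Site 2 L) := P.image (planeSite x₀ 0 1) with hPS
  have hinj : Set.InjOn (planeSite x₀ 0 1) (P : Set (ZMod L × ZMod L)) := by
    intro p _ q _ hpq
    rw [(planeSite_eq_iff x₀ _ p).mp hpq, ← (planeSite_eq_iff x₀ _ q).mp rfl]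
  have hPScard : PS.card = P.card := by rw [hPS, Finset.card_image_of_injOn hinj]
  have hset : {U : GaugeConfig 2 L Circle | (P.card : ℝ) * (1 - Real.cos (Real.pi / P.card)) ≤
      patchAction x₀ 0 1 P U} =
      {U | (P.card : ℝ) * (1 - Real.cos (Real.pi / P.card)) ≤
        ∑ x ∈ PS, (1 - ((plaquetteHolonomy U x 0 1 : Circle) : ℂ).re)} := by
    ext U
    simp only [Set.mem_setOf_eq, patchAction, hPS, Finset.sum_image hinj]
  have htail := u1_pow_mul_measure_actionSum_ge_le hL hLe hβ PS n (by rw [hPScard]; exact hPn) hn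
    ((P.card : ℝ) * (1 - Real.cos (Real.pi / P.card)))
  rw [hPScard, ← hset] at htail
  calc z1 u1Rep β ^ (n + P.card) * (μW ⊗ₘ κ) {q | Flux.topCharge x₀ 0 1 q.1 ≠ Flux.topCharge x₀ 0 1 q.2}
      ≤ z1 u1Rep β ^ (n + P.card) * (2 * μW {U | (P.card : ℝ) * (1 - Real.cos (Real.pi / P.card)) ≤
          patchAction x₀ 0 1 P U}) := mul_le_mul' le_rfl hlaw
    _ = 2 * (z1 u1Rep β ^ (n + P.card) * μW {U | (P.card : ℝ) * (1 - Real.cos (Real.pi / P.card)) ≤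
          patchAction x₀ 0 1 P U}) := by ring
    _ ≤ _ := mul_le_mul' le_rfl htail

end Summit.Ventures.LatticeQCDFlow.Theory2.Lattice.TwoDim
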